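import Mathlib
import Summits.NavierStokesRegularity.NavierStokesRegularity.Theses.HeteroclinicTriggerChain
import HarnessLib

/-!
# `HeteroclinicTriggerChain.Assembly` — the route's assembly (item stmt-NavierStokesRegularity-22787;
  pure logic)

**Statement.** `TriggerChainTable → TriggerChainFrontStep → RestartControl → RestartGlue →
LocalDynamicsSufficesAt → TaoLadderRungThree.Target`.

PROOF. The route file `Theses/HeteroclinicTriggerChain.lean` carries the planner-authored,
kernel-checked deciding theorem `Theses.HeteroclinicTriggerChain.closes`, whose hypotheses are
exactly the route's two cruxes and three supports and whose conclusion is the rung leaf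
`TaoLadderRungThree.Target` (TL-M3, D-0061); the assembly item is that implication written as ONE
proposition, so it is closed by applying `closes` to the hypotheses.

HONEST FRAMING: glue between the route's own statements about a MODEL lattice (Tao 2016's cascade);
nothing here is a statement about the Navier–Stokes equations, and the rung leaf is not the summit
Statement.
-/

noncomputable section

set_option linter.dupNamespace false

namespace Summit.NavierStokesRegularity.NavierStokesRegularity.Theorems

open Summit.NavierStokesRegularity.NavierStokesRegularity.Theses.HeteroclinicTriggerChain in
/-- **Item stmt-NavierStokesRegularity-22787** (`HeteroclinicTriggerChain.Assembly`): the route's two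
cruxes and three supports imply its rung leaf `TaoLadderRungThree.Target`, by the route file's
deciding theorem `closes`. [this file] -/
theorem heteroclinicTriggerChain_assembly_proof :
    Summit.NavierStokesRegularity.NavierStokesRegularity.Theses.HeteroclinicTriggerChain.Assembly := by
  unfold Summit.NavierStokesRegularity.NavierStokesRegularity.Theses.HeteroclinicTriggerChain.Assembly
  intro h₁ h₂ h₃ h₄ h₅
  exact closes h₁ h₂ h₃ h₄ h₅

end Summit.NavierStokesRegularity.NavierStokesRegularity.Theorems

end
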